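import Literature.AnabelianGeometry.Anabelioids.FiniteEtaleLocalDictionary
import Literature.AnabelianGeometry.Anabelioids.FiniteEtaleLocalDictionaryLift
import HarnessLib

/-!
# Anabelioids: the local dictionary of a finite étale morphism, III — range `π₁(φ)` = stabiliser

Mochizuki, *The geometry of anabelioids*, Publ. RIMS **40** (2004), §1.2, Remark 1.2.2.1 p. 17
[cite: MochizukiGeoAn2004, Rem. 1.2.2.1 p.17]; *Semi-graphs of anabelioids*, Publ. RIMS **42**
(2006), Remark 2.2.1 p. 24: along a finite étale covering, `Π_{v'}` is "the stabilizer in `Π_𝒢`"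
of a pro-vertex [cite: MochizukiSemiAnbd2006, Rem. 2.2.1 p.24].

PROOF-ONLY (abc-iut L3 row `L3:FiniteEtaleLocalDictionary`, part 3, L6-t17).  Assembly of parts 1
and 2 for an arbitrary finite étale pull-back functor `Q ≅ (S × −) ⋙ α`, `α : C_{/S} ⥲ D`:

* `pi1Map_surjective_of_isEquivalence` — whiskering along an equivalence is surjective on `Aut`
  of basepoints (the whiskering functor is itself an equivalence, hence full);
* `exists_aut_pi1Map_eq_of_app_basePoint` — every automorphism of the basepoint `Q ⋙ F` of `C`
  fixing the base point `s₀ ∈ F(Q S)` is `π₁(φ)(σ)` for some `σ ∈ Aut F` (transport of part 2's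
  lift along `e` and `α`);
* `range_pi1Map_eq_stabilizer` — **`range π₁(φ) = Stab(s₀)`**, in the `Aut.autMulEquivOfIso`
  shape over any basepoint `G ≅ Q ⋙ F` of `C` (the shape `SemiGraphs.branchSubgroup` consumes).

With part 1 (`isPi1Mono_of_isFiniteEtale`, openness, index `= |G(S)|` for connected `S`) this is
the dictionary "`Π_Y ≅` an open subgroup of `Π_X` of index `deg`, namely a point stabiliser" for
finite étale morphisms of abstract connected anabelioids.
-/

namespace Literature.AnabelianGeometry.Anabelioids

open CategoryTheory CategoryTheory.Limits CategoryTheory.Functor CategoryTheory.PreGaloisCategory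

universe w u₁ u₂ u₃ u₄

section Whisker

variable {X : Type u₁} [Category.{u₂} X] {Y : Type u₃} [Category.{u₄} Y]

/-- Whiskering along an EQUIVALENCE `P` is surjective on automorphism groups of basepoints: every
automorphism of `P ⋙ F` is `π₁(P)(σ)` for some automorphism `σ` of `F` (the whiskering functor
`(X ⥤ FintypeCat) ⥤ (Y ⥤ FintypeCat)` is an equivalence, hence full and faithful).
[cite: MochizukiGeoAn2004, Def. 1.1.2(i) p.10] -/
theorem pi1Map_surjective_of_isEquivalence (P : Y ⥤ X) [P.IsEquivalence] (F : X ⥤ FintypeCat.{w}) :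
    Function.Surjective (pi1Map P F) := by
  let W : (X ⥤ FintypeCat.{w}) ⥤ (Y ⥤ FintypeCat.{w}) :=
    (Functor.whiskeringLeft Y X FintypeCat.{w}).obj P
  haveI : W.IsEquivalence :=
    (inferInstance : (P.asEquivalence.symm.congrLeft (E := FintypeCat.{w})).functor.IsEquivalence)
  intro σ₁
  refine ⟨W.preimageIso σ₁, ?_⟩
  exact Iso.ext (W.map_preimage σ₁.hom)

end Whisker

section Assembly

variable {C : Type u₁} [Category.{u₂} C] [GaloisCategory C]
  {D : Type u₁} [Category.{u₂} D] [GaloisCategory D] {S : C}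

/-- **Lifting the stabiliser, general finite étale case.** For `Q ≅ (S × −) ⋙ α` with `α` an
equivalence `C_{/S} ⥲ D` and a basepoint `F` of `D`: every automorphism `τ` of the basepoint
`Q ⋙ F` of `C` fixing the base point `s₀ = F(α(Δ) ≫ e⁻¹_S)(t) ∈ F(Q S)` is `π₁(φ)(σ)` for some
automorphism `σ` of `F` (part 2's lift for the transported basepoint `α ⋙ F` of `C_{/S}`, moved
along `e` and along the equivalence `α`). [cite: MochizukiSemiAnbd2006, Rem. 2.2.1 p.24] -/
theorem exists_aut_pi1Map_eq_of_app_basePoint (α : Over S ⥤ D) [α.IsEquivalence] {Q : C ⥤ D}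
    (e : Q ≅ Over.star S ⋙ α) (F : D ⥤ FintypeCat.{u₂}) [FiberFunctor F]
    (t : F.obj (α.obj (Over.mk (𝟙 S)))) (τ : Aut (Q ⋙ F))
    (hτ : τ.hom.app S
        (F.map (α.map ((Over.forgetAdjStar S).unit.app (Over.mk (𝟙 S))) ≫ e.inv.app S) t) =
      F.map (α.map ((Over.forgetAdjStar S).unit.app (Over.mk (𝟙 S))) ≫ e.inv.app S) t) :
    ∃ σ : Aut F, pi1Map Q F σ = τ := by
  haveI : Subsingleton ((α ⋙ F).obj (Over.mk (𝟙 S))) := subsingleton_fiber_mkId α F (S := S)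
  -- transport `τ` along `e` to an automorphism of `(S × −) ⋙ (α ⋙ F)`
  let τ₁ : (Over.star S ⋙ α) ⋙ F ≅ (Over.star S ⋙ α) ⋙ F :=
    (isoWhiskerRight e F).symm ≪≫ τ ≪≫ isoWhiskerRight e F
  have hτ₁_app : ∀ (A : C), τ₁.hom.app A =
      F.map (e.inv.app A) ≫ τ.hom.app A ≫ F.map (e.hom.app A) := fun A => rfl
  -- `F(e_S) ∘ F(e⁻¹_S) = id` and `F(α(Δ) ≫ e⁻¹_S) = F(e⁻¹_S) ∘ F(α(Δ))`, elementwise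
  have hm : ∀ y : F.obj ((Over.star S ⋙ α).obj S),
      F.map (e.hom.app S) (F.map (e.inv.app S) y) = y := fun y =>
    ConcreteCategory.congr_hom (F.mapIso (e.app S)).inv_hom_id y
  have h2 : F.map (e.inv.app S) (F.map (α.map ((Over.forgetAdjStar S).unit.app (Over.mk (𝟙 S)))) t) =
      F.map (α.map ((Over.forgetAdjStar S).unit.app (Over.mk (𝟙 S))) ≫ e.inv.app S) t :=
    (ConcreteCategory.congr_hom (F.map_comp _ _) t).symm
  -- the base point is fixed by `τ₁`
  have hτ₁ : τ₁.hom.app S ((α ⋙ F).map ((Over.forgetAdjStar S).unit.app (Over.mk (𝟙 S))) t) =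
      (α ⋙ F).map ((Over.forgetAdjStar S).unit.app (Over.mk (𝟙 S))) t := by
    show F.map (e.hom.app S) (τ.hom.app S (F.map (e.inv.app S)
      (F.map (α.map ((Over.forgetAdjStar S).unit.app (Over.mk (𝟙 S)))) t))) =
      F.map (α.map ((Over.forgetAdjStar S).unit.app (Over.mk (𝟙 S)))) t
    rw [h2, hτ, ← h2]
    exact hm _
  -- part 2: lift on `C_{/S}`
  obtain ⟨σ₁, hσ₁⟩ := exists_aut_pi1Map_star_eq (α ⋙ F) t τ₁ hτ₁
  -- move along the equivalence `α`
  obtain ⟨σ, hσ⟩ := pi1Map_surjective_of_isEquivalence α F σ₁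
  refine ⟨σ, Iso.ext (NatTrans.ext (funext fun A => ?_))⟩
  -- `σ_{α(S × A)} = τ₁_A`
  have h1 : σ.hom.app ((Over.star S ⋙ α).obj A) =
      F.map (e.inv.app A) ≫ τ.hom.app A ≫ F.map (e.hom.app A) := by
    have h := congrArg (fun ρ : Aut (Over.star S ⋙ α ⋙ F) => ρ.hom.app A) hσ₁
    rw [← hσ] at h
    simp only [pi1Map_hom_app] at h
    exact h.trans (hτ₁_app A)
  -- naturality of `σ` along `e_A : Q A ⟶ α(S × A)`
  have hnat := σ.hom.naturality (e.hom.app A)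
  rw [h1, ← Category.assoc, ← F.map_comp, Iso.hom_inv_id_app, F.map_id] at hnat
  erw [Category.id_comp] at hnat
  rw [pi1Map_hom_app]
  exact ((cancel_mono (F.map (e.hom.app A))).mp hnat.symm)

/-- **Range `π₁(φ)` = stabiliser of the base point** ([SemiAnbd] Rem. 2.2.1: along a finite étale
morphism `Π_Y` is the stabiliser in `Π_X` of a point of the fibre), for abstract connected
anabelioids, in the shape `SemiGraphs` consumes: for any basepoint `G` of `C` with `β : Q ⋙ F ≅ G`,
the image of `Aut F → Aut (Q ⋙ F) ⥲ Aut G` is the stabiliser in `Aut G` of `β(s₀) ∈ G(S)`.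
[cite: MochizukiSemiAnbd2006, Rem. 2.2.1 p.24] -/
theorem range_pi1Map_eq_stabilizer (α : Over S ⥤ D) [α.IsEquivalence] {Q : C ⥤ D}
    (e : Q ≅ Over.star S ⋙ α) (F : D ⥤ FintypeCat.{u₂}) [FiberFunctor F]
    {G : C ⥤ FintypeCat.{u₂}} (β : Q ⋙ F ≅ G) (t : F.obj (α.obj (Over.mk (𝟙 S)))) :
    ((Aut.autMulEquivOfIso β).toMonoidHom.comp (pi1Map Q F)).range =
      MulAction.stabilizer (Aut G) (β.hom.app S
        (F.map (α.map ((Over.forgetAdjStar S).unit.app (Over.mk (𝟙 S))) ≫ e.inv.app S) t)) := by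
  refine le_antisymm (range_pi1Map_le_stabilizer α e F β t) ?_
  intro ρ hρ
  rw [MulAction.mem_stabilizer_iff, mulAction_def] at hρ
  -- pull `ρ` back to `Aut (Q ⋙ F)` and check it fixes `s₀`
  let τ : Aut (Q ⋙ F) := (Aut.autMulEquivOfIso β).symm ρ
  have hτρ : (Aut.autMulEquivOfIso β) τ = ρ := (Aut.autMulEquivOfIso β).apply_symm_apply ρ
  have hτ_app : τ.hom.app S = β.hom.app S ≫ ρ.hom.app S ≫ β.inv.app S := rfl
  have hτ : τ.hom.app S
      (F.map (α.map ((Over.forgetAdjStar S).unit.app (Over.mk (𝟙 S))) ≫ e.inv.app S) t) =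
      F.map (α.map ((Over.forgetAdjStar S).unit.app (Over.mk (𝟙 S))) ≫ e.inv.app S) t := by
    rw [hτ_app, FintypeCat.comp_apply, FintypeCat.comp_apply, hρ, ← FintypeCat.comp_apply,
      Iso.hom_inv_id_app]
    rfl
  obtain ⟨σ, hσ⟩ := exists_aut_pi1Map_eq_of_app_basePoint α e F t τ hτ
  exact ⟨σ, by simp [hσ, hτρ]⟩

end Assembly

end Literature.AnabelianGeometry.Anabelioids
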